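import Literature.AlgebraicTopology.SingularHomology.CupRightComparison
import Literature.AlgebraicTopology.SingularHomology.CupRightPullback
import HarnessLib

/-!
# The comparison `H^*_X(W) ≅ H^*(↥W)` is natural under pull-backs

Topic `Literature/AlgebraicTopology/SingularHomology`. A. Hatcher, *Algebraic Topology* (2002),
§3.1 p. 199 (induced homomorphisms) with §2.1 p. 111: the cohomology of a subset `W` computed in
the chains of the ambient space `X` (`subsetCochains`, `H^p_X(W)`) is identified with the singular
cohomology of the subspace `↥W` (`subsetCochains.homologyIsoSingularCohomology`), and under this
identification the pull-back `subsetCochains.pullH f` along `f : X → Y` with `f(U) ⊆ V`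
(`SubsetCochainsPullback.lean`) is the map induced by the restriction `↥U → ↥V` of `f`.  This lets
homotopy invariance and the computations of singular cohomology be imported into the model
`H^*_X(W)` used for the Leray–Hirsch argument (Husemoller, *Fibre Bundles*, Ch. 17 §1).

* `subsetCochains.restrictMap f h : C(↥U, ↥V)` — the restriction of `f`;
* `subsetCochains.homologyIsoSingularCohomology_hom_pullH` — **`iso_U (f* y) = (f|)^* (iso_V y)`**;
* `subsetCochains.pullH_bijective_iff` — `f*` is bijective on `H^p` iff `(f|)*` is.

Everything is proved; no named facts.

## References

* [HatcherAT2002] A. Hatcher, *Algebraic Topology*, CUP 2002, §3.1 p. 199, §2.1 p. 111.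
* [HusemollerFibreBundles1994] D. Husemoller, *Fibre Bundles*, 3rd ed. (1994), Ch. 17 §1 Thm. 1.1.
-/

noncomputable section

-- as in `CupRightComparison`: chains of the concrete complex are `Finsupp`s up to unfolding of
-- semireducible definitions
set_option backward.isDefEq.respectTransparency false

open CategoryTheory Limits

universe u v

namespace Literature.AlgebraicTopology.SingularHomology

namespace subsetCochains

variable {R : Type v} [CommRing R] {X Y : Type u} [TopologicalSpace X] [TopologicalSpace Y]
  (f : C(X, Y)) {U : Set X} {V : Set Y} (h : Set.MapsTo f U V)

/-- Local notation: the coefficient object `ULift R` of `ModuleCat.{max u v} R`. -/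
local notation "𝑹" => SimplexSpan.coefR R

/-- The restriction `↥U → ↥V` of `f` (for `f(U) ⊆ V`). [folklore] -/
def restrictMap : C(↥U, ↥V) :=
  ⟨h.restrict f U V, (f.continuous.comp continuous_subtype_val).subtype_mk _⟩

/-- The restriction followed by the inclusion of `V` is `f` on the inclusion of `U`. [folklore] -/
theorem valMap_comp_restrictMap : (valMap V).comp (restrictMap f h) = f.comp (valMap U) := rfl

/-- **The comparison isomorphisms commute with pull-back: `iso_U (f* y) = (f|)* (iso_V y)`**
(Hatcher 2002, §3.1 p. 199: `f^♯φ = φ ∘ f_♯` on cochains as functions on simplices).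
[cite: HatcherAT2002, §3.1 p. 199] -/
theorem homologyIsoSingularCohomology_hom_pullH (n : ℕ) (y : (subsetCochains R 𝑹 V).homology n) :
    (homologyIsoSingularCohomology R U n).hom (pullH (N := 𝑹) f h n y) =
      singularCohomology.map R R (restrictMap f h) n ((homologyIsoSingularCohomology R V n).hom y) := by
  obtain ⟨ψ, hψ, rfl⟩ := homologyCls_surjective y
  -- both sides are classes of explicit cochains of `↥U`
  have hd₁ := d_hom_f_eq_zero (pull R 𝑹 f h) ψ hψ
  have eL : (homologyIsoSingularCohomology R U n).hom (pullH (N := 𝑹) f h n (homologyCls ψ hψ)) =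
      homologyCls (K := singularCochainComplex R R (↥U))
        ((isoSingularCochainComplex R U).hom.f n ((pull R 𝑹 f h).f n ψ))
        (d_hom_f_eq_zero (isoSingularCochainComplex R U).hom _ hd₁) := by
    have e1 : pullH (N := 𝑹) f h n (homologyCls ψ hψ) = homologyCls ((pull R 𝑹 f h).f n ψ) hd₁ :=
      homologyMap_homologyCls (pull R 𝑹 f h) ψ hψ
    rw [e1]
    exact homologyMap_homologyCls (isoSingularCochainComplex R U).hom _ _
  have hd₂ := d_hom_f_eq_zero (isoSingularCochainComplex R V).hom ψ hψ
  have eR : singularCohomology.map R R (restrictMap f h) n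
      ((homologyIsoSingularCohomology R V n).hom (homologyCls ψ hψ)) =
      homologyCls (K := singularCochainComplex R R (↥U))
        ((singularCochainComplex.map R R (restrictMap f h)).f n ((isoSingularCochainComplex R V).hom.f n ψ))
        (d_hom_f_eq_zero (singularCochainComplex.map R R (restrictMap f h)) _ hd₂) := by
    have e1 : (homologyIsoSingularCohomology R V n).hom (homologyCls ψ hψ) =
        homologyCls (K := singularCochainComplex R R (↥V)) ((isoSingularCochainComplex R V).hom.f n ψ) hd₂ :=
      homologyMap_homologyCls (isoSingularCochainComplex R V).hom ψ hψ
    rw [e1]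
    exact homologyMap_homologyCls (singularCochainComplex.map R R (restrictMap f h)) _ _
  refine eL.trans ((homologyCls_congr ?_ _ _).trans eR.symm)
  rw [isoSingularCochainComplex_hom_f_apply, isoSingularCochainComplex_hom_f_apply]
  funext τ
  rw [singularCochainComplex.map_apply, toFun_pull f h _ (range_map_valMap_subset τ),
    ← SingularSimplex.map_comp, ← SingularSimplex.map_comp, valMap_comp_restrictMap]

/-- **`f* : H^p_Y(V) → H^p_X(U)` is bijective iff `(f|)* : H^p(↥V) → H^p(↥U)` is.** [folklore] -/
theorem pullH_bijective_iff (n : ℕ) :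
    Function.Bijective (pullH (N := 𝑹) f h n) ↔
      Function.Bijective (singularCohomology.map R R (restrictMap f h) n) := by
  have hsq : (fun y ↦ (homologyIsoSingularCohomology R U n).hom (pullH (N := 𝑹) f h n y)) =
      fun y ↦ singularCohomology.map R R (restrictMap f h) n ((homologyIsoSingularCohomology R V n).hom y) :=
    funext (homologyIsoSingularCohomology_hom_pullH f h n)
  have eU := (ConcreteCategory.isIso_iff_bijective (homologyIsoSingularCohomology R U n).hom).1 inferInstance
  have eV := (ConcreteCategory.isIso_iff_bijective (homologyIsoSingularCohomology R V n).hom).1 inferInstance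
  constructor
  · intro hb
    have h2 : Function.Bijective ((singularCohomology.map R R (restrictMap f h) n) ∘
        (homologyIsoSingularCohomology R V n).hom) := by
      change Function.Bijective (fun y ↦ singularCohomology.map R R (restrictMap f h) n
        ((homologyIsoSingularCohomology R V n).hom y))
      rw [← hsq]; exact eU.comp hb
    exact (Function.Bijective.of_comp_iff _ eV).1 h2
  · intro hb
    have h2 : Function.Bijective ((homologyIsoSingularCohomology R U n).hom ∘ (pullH (N := 𝑹) f h n)) := by
      change Function.Bijective (fun y ↦ (homologyIsoSingularCohomology R U n).hom (pullH (N := 𝑹) f h n y))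
      rw [hsq]; exact hb.comp eV
    exact (Function.Bijective.of_comp_iff' eU _).1 h2

end subsetCochains

end Literature.AlgebraicTopology.SingularHomology
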